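import Mathlib
import Literature.NumberTheory.Transcendental.ZagierDilogarithmConjecture
import Literature.NumberTheory.Transcendental.BlochWignerDilogarithm
import Summits.KontsevichZagierPeriods.KontsevichZagierPeriods.Theorems.HyperbolicBlochZagierDilogarithmConjectureDehnRigidity
import HarnessLib

/-!
# `ZagierDilogarithmConjecture` (stmt-KontsevichZagierPeriods-10550) — line
`kummer-clausen-linearisation`, stub `stub_quarticSector`

**Zagier's conjecture holds UNCONDITIONALLY on the fourth roots of unity.** Let
`D = blochWignerDilog` be the Bloch–Wigner dilogarithm and `C = ⟨dilogRelators⟩ ⊆ ℤ[ℂ]` the relator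
group. If `u₁, …, u_k` are fourth roots of unity in the upper half plane and `n₁, …, n_k ∈ ℤ`
satisfy `Σ nᵢ D(uᵢ) = 0`, then `Σ nᵢ [uᵢ] ∈ C`.

Proof (what / why).
* `μ₄ ∩ ℍ⁺ = {i}` (`QuarticSector.eq_I`): `u⁴ − 1 = (u − 1)(u + 1)(u + i)(u − i)`, and the roots
  `1, −1, −i` have imaginary part `≤ 0`.
* Hence every `uᵢ = i`, the relation reads `(Σ nᵢ) · D(i) = 0`, and `D(i) > 0`
  (`blochWignerDilog_pos`, positivity of `D` on `ℍ⁺`) forces `Σ nᵢ = 0`, so that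
  `Σ nᵢ [uᵢ] = (Σ nᵢ) • [i] = 0 ∈ C`.
Mathlib + the tree's positivity file only; sorry-free; axioms ⊆ {propext, Classical.choice, Quot.sound}.

## References

* W. D. Neumann, *Hilbert's 3rd problem and invariants of 3-manifolds*, Geom. Topol. Monogr. 1
  (1998), §2.1 (the relator group, Zagier's conjecture). [Neumann1998]
* J. Milnor, *Hyperbolic geometry: the first 150 years*, Bull. AMS 6 (1982), Appendix
  (positivity of the volume function). [Milnor1982]
-/

noncomputable section

open scoped BigOperators ComplexConjugate
open Literature.NumberTheory.Transcendental

namespace Summit.KontsevichZagierPeriods.HyperbolicBloch.ZagierDilogarithmCyclotomic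

open Summit.KontsevichZagierPeriods.HyperbolicBloch.ZagierDilogarithm (blochWignerDilog_pos)

namespace QuarticSector

/-- `u⁴ − 1 = (u − 1)(u + 1)(u + i)(u − i)` over `ℂ`. [folklore] -/
theorem pow_four_sub_one_eq (u : ℂ) :
    u ^ 4 - 1 = (u - 1) * (u + 1) * (u + Complex.I) * (u - Complex.I) := by
  linear_combination (u ^ 2 - 1) * Complex.I_sq

/-- **`μ₄ ∩ ℍ⁺ = {i}`**: a fourth root of unity with positive imaginary part is `i` (the other
three, `1, −1, −i`, have imaginary part `≤ 0`). [folklore] -/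
theorem eq_I {u : ℂ} (hu : u ^ 4 = 1) (him : 0 < u.im) : u = Complex.I := by
  have h : (u - 1) * (u + 1) * (u + Complex.I) * (u - Complex.I) = 0 := by
    rw [← pow_four_sub_one_eq, hu, sub_self]
  rcases mul_eq_zero.1 h with h | h
  · exfalso
    rcases mul_eq_zero.1 h with h | h
    · rcases mul_eq_zero.1 h with h | h
      · have h' := congrArg Complex.im h
        simp only [Complex.sub_im, Complex.one_im, sub_zero, Complex.zero_im] at h'
        exact him.ne' h'
      · have h' := congrArg Complex.im h
        simp only [Complex.add_im, Complex.one_im, add_zero, Complex.zero_im] at h'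
        exact him.ne' h'
    · have h' := congrArg Complex.im h
      simp only [Complex.add_im, Complex.I_im, Complex.zero_im] at h'
      linarith
  · exact sub_eq_zero.1 h

end QuarticSector

open QuarticSector in
/-- **Zagier's conjecture for fourth roots of unity (UNCONDITIONAL)** (stub `stub_quarticSector`
of line `kummer-clausen-linearisation`): a `ℤ`-relation `Σ nᵢ D(uᵢ) = 0` among Bloch–Wigner values
at points `uᵢ ∈ μ₄ ∩ ℍ⁺ = {i}` is explained, `Σ nᵢ [uᵢ] ∈ ⟨dilogRelators⟩`: the relation is
`(Σ nᵢ) D(i) = 0`, `D(i) > 0` forces `Σ nᵢ = 0`, and then `Σ nᵢ [uᵢ] = (Σ nᵢ) • [i] = 0`.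
[cite: Milnor1982, Appendix] -/
theorem stub_quarticSector :
    ∀ (k : ℕ) (u : Fin k → ℂ) (n : Fin k → ℤ), (∀ i, u i ^ 4 = 1) → (∀ i, 0 < (u i).im) →
      ∑ i, (n i : ℝ) * blochWignerDilog (u i) = 0 →
        (∑ i, n i • FreeAbelianGroup.of (u i)) ∈ AddSubgroup.closure dilogRelators := by
  intro k u n hu him hrel
  have hI : ∀ i, u i = Complex.I := fun i => eq_I (hu i) (him i)
  simp only [hI] at hrel ⊢
  rw [← Finset.sum_mul] at hrel
  have hpos : 0 < blochWignerDilog Complex.I := blochWignerDilog_pos (by simp)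
  have hsum : (∑ i, (n i : ℝ)) = 0 := (mul_eq_zero.1 hrel).resolve_right hpos.ne'
  have hsum' : ∑ i, n i = 0 := by exact_mod_cast hsum
  rw [← Finset.sum_smul, hsum', zero_smul]
  exact zero_mem _

end Summit.KontsevichZagierPeriods.HyperbolicBloch.ZagierDilogarithmCyclotomic

end
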